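import Summits.QuantumFields.YangMills.Theorems.FluctuationComparisonRegPrIntLS2BetaSymmetriesLiftOfCritical
import Summits.QuantumFields.YangMills.Theorems.FluctuationComparisonRegPrIntLIsolOfOrbBar
import Summits.QuantumFields.YangMills.Theorems.FluctuationComparisonRegPrIntLS2BetaTubeLettersOrbitTransport
import Summits.QuantumFields.YangMills.Theorems.FluctuationComparisonRegPrIntLS2BetaResidualGaugeOrbit
import Summits.QuantumFields.YangMills.Theorems.FluctuationComparisonRegPrIntLS2BetaWindowCornerQTube
import Summits.QuantumFields.YangMills.Theorems.FluctuationComparisonRegPrIntLS2BetaTableDiagonalOrgans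
import Summits.QuantumFields.YangMills.Theorems.FluctuationComparisonRegPrIntLS2BetaFibreTransport
import Literature.MathematicalPhysics.QuantumFieldTheory.Balaban1983to89.B16Thm1BaseAtRecord11
import HarnessLib

/-!
# S2β · THE v12-CANDIDATE ORGAN GAP♭∘ AT EVERY BLOCK SIZE `L ≥ 5` READS ONE ORGAN-SHAPED LETTER: REG-ARGMIN̄∘ («closed-window achievers are (6)-regular»),
# WITH A UNIFORM COUPLING THRESHOLD — AND GIVES IT BACK (crux `FluctuationComparisonRegPrIntL`, stmt-QuantumFields-20520)

Cell `ym3-torus` (YM ladder rung R3 = continuum `SU(2)` Yang–Mills on T³ — a RUNG, NOT d = 4, NOT infinite volume, NOT a mass gap, NOT Clay); width seat `ym3-torus-px17`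
(gen 17; lineage px17 g14 FINDING Q-GAP♯-UNIFORMITY + CERT GAP♭∘ 603780ac, g15 `sigmaGrowth_holds`, g16 FILE 1∕3); `--supports stmt-QuantumFields-20520 --as helper`,
count-neutral, DEFINITION-FREE, default heartbeats; registry v11.4 `Cruxes/FluctuationComparisonRegPrIntL/Lines/semiclassical_s2beta.lean` 3732b7df UNTOUCHED.

THE TWO TEXTS (both under the organs' common prefix `∃ c₀ … ∀ cw … ∃ pS … ∀ b₀ p₀ … ∃ ε₁ … ∀ ε₀ … ∃ γ₁ … ∀ F γ … ∀ J K (hJK : J ≤ K) V, PlaqSmall (θBal F.L γ (cw·b₀) p₀ J) V →`,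
read AT ONE block size `L`):
* GAP♭∘-at-`L` = px17 g14's v12 candidate text of `UniformFibreGapOrbit` (CERT `CERT-v12cand-GAPflat` 603780ac: `∃ μ` AFTER the base point `U₀ ∈ argminHist V`, the coupling
  threshold `γ₁` UNIFORM — chosen before `F, γ, J, K, V`), `argminHist`∕`ResidualGauge` δ-unfolded exactly as in ✓p792429 `orb_of_gapFlat`'s binder `hG`;
* REG-ARGMIN̄∘-at-`L` = px17 g14's per-datum letter `hRA` of ✓`orbBar_of_atMostOneCriticalOrbit` («every `U ∈ closure (fibre V ∩ histGood)` with
  `A U ≤ minActionRegPr ε₀ V` is `RegPr ε₀`» — [Balaban1985Variational] Thm 1 (9)–(10)'s regularity-of-minimisers content incl. boundary achievers) under the SAME prefix.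

WHAT (compositions BY NAME; every other per-datum letter of the (T)-chain is DISCHARGED by tree theorems):
* §1 ★★★ `gapFlat_at_min_of_regArgminBar_five` — GAP♭(V,U₀) at print's regular good minimiser with a UNIFORM coupling threshold `γ₁(L,b₀,p₀)` ⟸ REG-ARGMIN̄(V) ALONE
  (`L ≥ 5`, `ε₀ ≤ e(L)`): ✓p793697 `gapFlatAt_of_pos_of_atMostOneCriticalOrbit_of_closePair` at the FIXED tube radius `δ := 1` (so CLOSE-PAIR's `γ₁(δ)` is uniform — the
  per-base-point `γ*(U₀)` of ✓p802907 ∕ ✓p807920 `gapFlat_at_min_five` came only from discharging `hreg` at the openness radius `δ₀(U₀)` of the regular class), with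
  POS∘ ⟸ ✓px17 g16 `posCollar_at_isCritR2_of_lift_five'` ∘ ✓px13 g21 `symmetriesLift_of_isCritR2_five` (every `δ`), Prop. 7 cl. 1 ⟸ ✓px13 g21 `atMostOneCriticalOrbit_five`,
  CL ⟸ ✓`exists_gamma_closedGoodFibre`.
* §2 ★★ `gapFlatAt_argmin_of_gapFlatAt` — base-point transfer: GAP♭(V,U₁;μ) at ONE fibre point `U₁` ⟹ GAP♭(V,U₀;μ) at EVERY `U₀ ∈ argminHist V`, same `μ`
  (`U₀`'s excess vanishes ⇒ `U₀ = w₀ • U₁` by ✓`exists_eq_gaugeAct_of_iInf_le_zero`; ✓`gapFlatAt_gaugeAct_iff` at the residual `w₀`, whose descent fixes `V`).  So the organ's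
  base points need NOT be assumed (6)-regular — REG-ARGMIN is not a separate letter.
* §3 ★★★★ `gapFlatOrganAt_five_of_regArgminBarOrganAt` — **GAP♭∘-at-`L` ⟸ REG-ARGMIN̄∘-at-`L`, every `L ≥ 5`** (thresholds merged by `min`∕`max`; base point from
  ✓`windowExactnessExistsAt_five`; diagonal `K = J` by ✓w5 `gapOrbit_self`).
* §4 ★★ `regArgminBarAt_of_gapFlatAt` (per datum) and ★★★ `regArgminBarOrganAt_five_of_gapFlatOrganAt` — **THE CONVERSE: GAP♭∘-at-`L` ⟹ REG-ARGMIN̄∘-at-`L`, every `L ≥ 5`**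
  (the GAP♭ inequality at the clause-(2) regular good minimiser `U₁` is a CLOSED condition in `U` — ✓`continuous_iInf_orbitDistSq`, ✓`continuous_wilsonAction4_SU` — so it holds on
  `closure (fibre ∩ histGood)`; an achiever there has vanishing orbit distance, is `w • U₁` with `w` residual, and is regular with `U₁`, ✓`gaugeAct_mem_regFibrePr_iff_of_residual`).

NET FOR THE GAP LIST (UV3-NODE §47.3∕§48.3 items (iii)–(iv), by kernel): under the docketed v12 re-key GAP♯∘ ↦ GAP♭∘ (px17 g14: the registry's consumers never read
`μ`'s uniformity), the organ GAP♭∘ at every `L ≥ 5` is EQUIVALENT by kernel (§3 + §4, thresholds re-merged each way) to the single letter REG-ARGMIN̄∘ — print's regularity of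
(closed-window) minimisers, uniformly in the coupling; POS∘ ((142) with rate), `hlift`, Prop. 7 cl. 1, ISOL∘, CL, Thm 1 (8) are all paid, and NO per-base-point coupling
threshold survives.  EXW∘ at `L ≥ 5` is px13 g21's ✓`windowExactness_body_five` (tower monotonicity, no letter); whether REG-ARGMIN̄∘-at-`L` itself follows from the
tower (px13 g21 FILE D `regPr_of_argmin` + a closure slack on the profile) is the next file, not this one; `L = 3` stays EMBARGO-LITE №58.

HONEST SCOPE (CREDIT NOTHING): plumbing ∕ one closedness argument over landed theorems; REG-ARGMIN̄∘ and GAP♭∘ are HYPOTHESES where displayed ([Balaban1985Variational] Thm 1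
(8)–(10) content); GAP♯∘ as registered (uniform `μ`), EXW∘ at `L = 3`, TUBE-REG∘, DET-REP-B, H4ᶜ∘, LFR♯ᶜ∘, S2β, crux 20520, 19936, 19200 and `YM3TorusSU2` are NOT proved;
no registered stub is closed; rung R3 = SU(2) YM₃ on T³ at fixed lattice data — NOT d = 4, NOT infinite volume, NOT a mass gap, NOT Clay; the Yang–Mills mass gap is NOT
proved.  Sorry-free, axioms standard.

References: T. Bałaban, CMP **102** (1985) 277–309 [Balaban1985Variational] ((4)–(6) p.278, Thm 1 (8)–(10) p.279, Prop. 7 and (141)–(143) p.299); CMP **102** (1985)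
255–275 [Balaban1985UV3] ((7) p.257, (12)–(13) p.259, (18)–(22) p.260, (41) p.266); CMP **99** (1985) 75–102 [Balaban1985RegularSpaces] ((1.7)–(1.9) p.77, Thm 2 p.83);
CMP **98** (1985) 17–51 [Balaban1985Averaging] ((8), (11) p.19).
-/

set_option autoImplicit false

noncomputable section

namespace Summit.QuantumFields.YangMills.Theorems.FluctuationComparisonRegPrIntLS2BetaGapFlatOrganOfRegArgminBar

open MeasureTheory Filter Topology Set
open scoped Matrix.Norms.L2Operator
open Literature.MathematicalPhysics.QuantumFieldTheory.Balaban1983to89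
open Literature.MathematicalPhysics.QuantumFieldTheory.Balaban1983to89.T3ContinuumYM3Torus
open Literature.MathematicalPhysics.QuantumFieldTheory.Balaban1983to89.T3UnitLawDensityEML (ℰp)
open Literature.MathematicalPhysics.QuantumFieldTheory.Balaban1983to89.T3UnitScaleTilt
open Literature.MathematicalPhysics.QuantumFieldTheory.Balaban1983to89.T3TiltDescent
open Literature.MathematicalPhysics.QuantumFieldTheory.Balaban1983to89.T3ConstrainedMinimiser (fibre)
open Literature.MathematicalPhysics.QuantumFieldTheory.Balaban1983to89.T3PrintedRegularMinimiser
open Literature.MathematicalPhysics.QuantumFieldTheory.Balaban1983to89.T3PrintedRegularOrbits (descTransf)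
open Literature.MathematicalPhysics.QuantumFieldTheory.Balaban1983to89.T3Thm1Carrier (varProblem3)
open Literature.MathematicalPhysics.QuantumFieldTheory.Balaban1983to89.T3Thm1CarrierNative (IsCritR2 isCritR2_of_isMinOn)
open Literature.MathematicalPhysics.QuantumFieldTheory.Balaban1983to89.T4Continuum
open scoped Literature.MathematicalPhysics.QuantumFieldTheory.Balaban1983to89.T3OrbitAverage
open Summit.QuantumFields.YangMills.Theorems.FluctuationComparisonRegPrIntLS2BetaResidualGauge
  (residual_iff_descTransf gaugeAct_mem_regFibrePr_iff_of_residual)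
open Summit.QuantumFields.YangMills.Theorems.FluctuationComparisonRegPrIntLS2BetaResidualGaugeOrbit (exists_eq_gaugeAct_of_iInf_le_zero)
open Summit.QuantumFields.YangMills.Theorems.FluctuationComparisonRegPrIntLS2BetaTubeLettersOrbitTransport (gapFlatAt_gaugeAct_iff)
open Summit.QuantumFields.YangMills.Theorems.FluctuationComparisonRegPrIntLS2BetaFibreTransport (continuous_iInf_orbitDistSq)
open Summit.QuantumFields.YangMills.Theorems.FluctuationComparisonRegPrIntLS2BetaGapFlatOfStabiliserLift (posCollar_at_isCritR2_of_lift_five')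
open Summit.QuantumFields.YangMills.Theorems.FluctuationComparisonRegPrIntLS2BetaSymmetriesLiftOfCritical
  (symmetriesLift_of_isCritR2_five atMostOneCriticalOrbit_five)
open Summit.QuantumFields.YangMills.Theorems.FluctuationComparisonRegPrIntLIsolOfOrbBar (gapFlatAt_of_pos_of_atMostOneCriticalOrbit_of_closePair)
open Summit.QuantumFields.YangMills.Theorems.FluctuationComparisonRegPrIntLClosedGoodFibre (exists_gamma_closedGoodFibre)
open Summit.QuantumFields.YangMills.Theorems.FluctuationComparisonRegPrIntLS2BetaWindowCornerQTube (windowExactnessExistsAt_five)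
open Summit.QuantumFields.YangMills.Theorems.FluctuationComparisonRegPrIntLS2BetaTableDiagonalOrgans (gapOrbit_self)

/-! ## §1 GAP♭ at print's regular good minimiser with a UNIFORM coupling threshold, from REG-ARGMIN̄(V) alone -/

section PerDatum

/-- ★★★ **GAP♭(V,U₀) AT PRINT'S REGULAR GOOD MINIMISER, UNIFORMLY IN `γ ≤ γ₁(L,b₀,p₀)`, FROM REG-ARGMIN̄(V) ALONE** (`L ≥ 5`).  For every `b₀, p₀ > 0` there are
`e > 0` (the `min` of the thresholds of ✓`posCollar_at_isCritR2_of_lift_five'`, ✓`symmetriesLift_of_isCritR2_five`, ✓`atMostOneCriticalOrbit_five`) and `γ₁ > 0` (the `min` of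
CL's ✓`exists_gamma_closedGoodFibre` and CLOSE-PAIR's `γ₁(δ := 1)`) such that at every member `(F, γ ≤ γ₁, J < K)`, every `0 < ε₀ ≤ e`, EVERY datum `V`, every good history
`U₀ ∈ regFibrePr ε₀ V` realising `minActionRegPr ε₀ V`: REG-ARGMIN̄(V) ⟹ `∃ μ > 0`, GAP♭(V,U₀;μ) (px17 g14's text VERBATIM).  The tube radius is FIXED at `1` — POS∘ holds at
every radius — which is what makes `γ₁` uniform. [cite: Balaban1985Variational, Thm 1 (8)-(10) p.279, Prop. 7 and (141)-(143) p.299; Balaban1985UV3, (12)-(13) p.259 and (18)-(22) p.260] -/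
theorem gapFlat_at_min_of_regArgminBar_five (L : ℕ) (h5 : 5 ≤ L) (b₀ p₀ : ℝ) (hb : 0 < b₀) (hp : 0 < p₀) :
    ∃ e γ₁ : ℝ, 0 < e ∧ 0 < γ₁ ∧
      ∀ (F : T3Family) (γ : ℝ), F.L = L → 0 < γ → γ ≤ γ₁ → ∀ (J K : ℕ) (hJK : J < K) (ε₀ : ℝ)
        (V : GaugeField (F.P J) 0 (Matrix.specialUnitaryGroup (Fin 2) ℂ)) (U₀ : GaugeField (F.P K) 0 (Matrix.specialUnitaryGroup (Fin 2) ℂ)),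
        0 < ε₀ → ε₀ ≤ e → U₀ ∈ regFibrePr F J K hJK.le ε₀ V →
        wilsonAction4 U₀ = minActionRegPr F J K hJK.le ε₀ V → U₀ ∈ histGood F ℰp (θBal F.L γ b₀ p₀) K J →
        (∀ U ∈ closure (fibre F ℰp J K hJK.le V ∩ histGood F ℰp (θBal F.L γ b₀ p₀) K J),
          wilsonAction4 U ≤ minActionRegPr F J K hJK.le ε₀ V → RegPr F J K ε₀ U) →
        ∃ μ : ℝ, 0 < μ ∧ ∀ U ∈ fibre F ℰp J K hJK.le V, U ∈ histGood F ℰp (θBal F.L γ b₀ p₀) K J →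
          μ * ((F.L : ℝ)⁻¹) ^ (2 * (K - J)) *
              (⨅ w : {w : Site (F.P K) 0 → Matrix.specialUnitaryGroup (Fin 2) ℂ |
                  ∀ U : GaugeField (F.P K) 0 (Matrix.specialUnitaryGroup (Fin 2) ℂ),
                    descendTo F ℰp J K hJK.le (GaugeField.gaugeAct w U) = descendTo F ℰp J K hJK.le U},
                ∑ ℓ : PBond (F.P K) 0,
                  dist1 (U ℓ * ((GaugeField.gaugeAct (w : Site (F.P K) 0 → Matrix.specialUnitaryGroup (Fin 2) ℂ) U₀) ℓ)⁻¹) ^ 2)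
            ≤ wilsonAction4 U - minActionRegPr F J K hJK.le ε₀ V := by
  obtain ⟨e₈, he₈, HP⟩ := posCollar_at_isCritR2_of_lift_five' L h5
  obtain ⟨e₈', he₈', HL⟩ := symmetriesLift_of_isCritR2_five L h5
  obtain ⟨e₉, he₉, H7⟩ := atMostOneCriticalOrbit_five L h5
  obtain ⟨γCL, hγCL, -, HCL⟩ := exists_gamma_closedGoodFibre L (b₀ := b₀) (p₀ := p₀) hb hp
  obtain ⟨γ₁, hγ₁, HG⟩ := gapFlatAt_of_pos_of_atMostOneCriticalOrbit_of_closePair L b₀ p₀ hb hp 1 one_pos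
  refine ⟨min e₈ (min e₈' e₉), min γCL γ₁, lt_min he₈ (lt_min he₈' he₉), lt_min hγCL hγ₁, ?_⟩
  intro F γ hF hγ hγle J K hJK ε₀ V U₀ hε₀ hεe hU₀reg hmin hU₀h hRA
  have hcrit : IsCritR2 F J K hJK.le V U₀ :=
    isCritR2_of_isMinOn hε₀ hU₀reg (isMinOn_iff.mpr fun W hW => hmin.trans_le (minActionRegPr_le F hW))
  have hlift := HL F hF J K hJK ε₀ V U₀ hε₀ (hεe.trans ((min_le_right _ _).trans (min_le_left _ _))) hU₀reg hcrit
  have hpos := HP F hF J K hJK γ b₀ p₀ ε₀ V U₀ 1 hε₀ (hεe.trans (min_le_left _ _)) hU₀reg hcrit hmin hlift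
  have h7 := H7 F hF J K hJK ε₀ V hε₀ (hεe.trans ((min_le_right _ _).trans (min_le_right _ _)))
  have hCL := HCL F γ hF hγ (hγle.trans (min_le_left _ _)) J K hJK.le V
  exact HG F γ hF hγ (hγle.trans (min_le_right _ _)) J K hJK.le ε₀ hε₀ V h7 U₀ hU₀reg hmin hU₀h hRA hCL hpos

end PerDatum

/-! ## §2 Base-point transfer: GAP♭ at one good fibre point gives GAP♭ at every point of `argminHist V`, same modulus -/

section Transfer

variable (F : T3Family) {J K : ℕ} (hJK : J ≤ K)

/-- ★★ **BASE-POINT TRANSFER ALONG THE RESIDUAL ORBIT.**  At one datum `V` and coupling data `(γ, b₀, p₀, ε₀ ≥ 0)`: if GAP♭(V,U₁;μ) holds at SOME fibre point `U₁` with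
`μ > 0`, then GAP♭(V,U₀;μ) holds at EVERY `U₀ ∈ argminHist V` (fibre ∧ good history ∧ `A U₀ = minActionRegPr ε₀ V`) with the SAME `μ`: `U₀`'s own excess vanishes, so its
orbit distance to `U₁` is `≤ 0` and `U₀ = w₀ • U₁` for a residual `w₀` (✓`exists_eq_gaugeAct_of_iInf_le_zero`); `w₀`'s descent fixes `V = D U₁` (✓`residual_iff_descTransf`),
and GAP♭ is equivariant (✓`gapFlatAt_gaugeAct_iff`). [cite: Balaban1985Variational, (4) p.278 and Thm 1 (8)-(10) p.279; Balaban1985Averaging, (8) and (11) p.19] -/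
theorem gapFlatAt_argmin_of_gapFlatAt {γ b₀ p₀ ε₀ : ℝ} (hε₀ : 0 ≤ ε₀)
    (V : GaugeField (F.P J) 0 (Matrix.specialUnitaryGroup (Fin 2) ℂ)) {U₁ : GaugeField (F.P K) 0 (Matrix.specialUnitaryGroup (Fin 2) ℂ)}
    (hU₁ : U₁ ∈ fibre F ℰp J K hJK V) {μ : ℝ} (hμ : 0 < μ)
    (hG : ∀ U ∈ fibre F ℰp J K hJK V, U ∈ histGood F ℰp (θBal F.L γ b₀ p₀) K J →
      μ * ((F.L : ℝ)⁻¹) ^ (2 * (K - J)) *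
          (⨅ w : {w : Site (F.P K) 0 → Matrix.specialUnitaryGroup (Fin 2) ℂ |
              ∀ U : GaugeField (F.P K) 0 (Matrix.specialUnitaryGroup (Fin 2) ℂ),
                descendTo F ℰp J K hJK (GaugeField.gaugeAct w U) = descendTo F ℰp J K hJK U},
            ∑ ℓ : PBond (F.P K) 0,
              dist1 (U ℓ * ((GaugeField.gaugeAct (w : Site (F.P K) 0 → Matrix.specialUnitaryGroup (Fin 2) ℂ) U₁) ℓ)⁻¹) ^ 2)
        ≤ wilsonAction4 U - minActionRegPr F J K hJK ε₀ V) :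
    ∀ U₀ ∈ {U' | U' ∈ fibre F ℰp J K hJK V ∧ U' ∈ histGood F ℰp (θBal F.L γ b₀ p₀) K J ∧
        wilsonAction4 U' = minActionRegPr F J K hJK ε₀ V},
      ∀ U ∈ fibre F ℰp J K hJK V, U ∈ histGood F ℰp (θBal F.L γ b₀ p₀) K J →
        μ * ((F.L : ℝ)⁻¹) ^ (2 * (K - J)) *
            (⨅ w : {w : Site (F.P K) 0 → Matrix.specialUnitaryGroup (Fin 2) ℂ |
                ∀ U : GaugeField (F.P K) 0 (Matrix.specialUnitaryGroup (Fin 2) ℂ),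
                  descendTo F ℰp J K hJK (GaugeField.gaugeAct w U) = descendTo F ℰp J K hJK U},
              ∑ ℓ : PBond (F.P K) 0,
                dist1 (U ℓ * ((GaugeField.gaugeAct (w : Site (F.P K) 0 → Matrix.specialUnitaryGroup (Fin 2) ℂ) U₀) ℓ)⁻¹) ^ 2)
          ≤ wilsonAction4 U - minActionRegPr F J K hJK ε₀ V := by
  intro U₀ hU₀
  obtain ⟨hU₀f, hU₀h, hU₀A⟩ := hU₀
  have hLpos : (0 : ℝ) < (F.L : ℝ) := Nat.cast_pos.mpr (lt_trans zero_lt_one F.hL.2)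
  have hc : 0 < μ * ((F.L : ℝ)⁻¹) ^ (2 * (K - J)) := mul_pos hμ (pow_pos (inv_pos.mpr hLpos) _)
  -- `U₀`'s own excess vanishes, so its orbit distance to `U₁` is `≤ 0`
  have h0 := hG U₀ hU₀f hU₀h
  rw [hU₀A, sub_self] at h0
  have hinf : (⨅ w : {w : Site (F.P K) 0 → Matrix.specialUnitaryGroup (Fin 2) ℂ |
        ∀ U : GaugeField (F.P K) 0 (Matrix.specialUnitaryGroup (Fin 2) ℂ),
          descendTo F ℰp J K hJK (GaugeField.gaugeAct w U) = descendTo F ℰp J K hJK U},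
      ∑ ℓ : PBond (F.P K) 0,
        dist1 (U₀ ℓ * ((GaugeField.gaugeAct (w : Site (F.P K) 0 → Matrix.specialUnitaryGroup (Fin 2) ℂ) U₁) ℓ)⁻¹) ^ 2) ≤ 0 := by
    by_contra hne
    push Not at hne
    exact absurd h0 (not_le.mpr (mul_pos hc hne))
  obtain ⟨w₀, hw₀, rfl⟩ := exists_eq_gaugeAct_of_iInf_le_zero F hJK U₀ U₁ hinf
  -- the descent of the residual `w₀` fixes `V = D U₁`
  have hfix : GaugeField.gaugeAct (descTransf F J K hJK w₀) V = V := by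
    have h := (residual_iff_descTransf F hJK).1 hw₀ U₁
    have hV : descendTo F ℰp J K hJK U₁ = V := hU₁
    rwa [hV] at h
  have key := gapFlatAt_gaugeAct_iff F hJK w₀ (γ := γ) (b₀ := b₀) (p₀ := p₀) hε₀ V U₁ μ
  rw [hfix] at key
  exact key.2 hG

end Transfer

/-! ## §3 ★★★★ GAP♭∘ AT `L` FROM REG-ARGMIN̄∘ AT `L`, every `L ≥ 5` -/

section Organ

/-- ★★★★ **GAP♭∘-at-`L` ⟸ REG-ARGMIN̄∘-at-`L`, AT EVERY BLOCK SIZE `L ≥ 5`.**  Hypothesis = REG-ARGMIN̄(V) under the organs' common prefix (read at `L`); conclusion =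
px17 g14's v12 candidate text GAP♭∘ read at `L` (δ-unfolded as in ✓`orb_of_gapFlat`).  Proof: thresholds of ✓`windowExactnessExistsAt_five` (the base point: a regular good
minimiser `U₁`), of the hypothesis and of §1 merged by `min`∕`max`; at `J < K` §1 gives GAP♭(V,U₁;μ) and §2 moves it to every `U₀ ∈ argminHist V`; the diagonal `K = J` is
✓`gapOrbit_self` (`μ := 1`). [cite: Balaban1985Variational, Thm 1 (8)-(10) p.279, Prop. 7 and (142) p.299; Balaban1985UV3, (18)-(22) p.260] -/
theorem gapFlatOrganAt_five_of_regArgminBarOrganAt (L : ℕ) (h5 : 5 ≤ L)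
    (hRA : ∃ c₀ : ℝ, 0 < c₀ ∧ c₀ ≤ 1 ∧ ∀ (cw : ℝ), 0 < cw → cw ≤ c₀ → ∃ pS : ℝ, ∀ (b₀ p₀ : ℝ), 0 < b₀ → pS ≤ p₀ → 0 < p₀ →
      ∃ ε₁ : ℝ, 0 < ε₁ ∧ ∀ (ε₀ : ℝ), 0 < ε₀ → ε₀ ≤ ε₁ →
      ∃ γ₁ : ℝ, 0 < γ₁ ∧ ∀ (F : T3Family) (γ : ℝ), F.L = L → 0 < γ → γ ≤ γ₁ →
        ∀ (J K : ℕ) (hJK : J ≤ K) (V : GaugeField (F.P J) 0 (Matrix.specialUnitaryGroup (Fin 2) ℂ)), PlaqSmall (θBal F.L γ (cw * b₀) p₀ J) V →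
          ∀ U ∈ closure (fibre F ℰp J K hJK V ∩ histGood F ℰp (θBal F.L γ b₀ p₀) K J),
            wilsonAction4 U ≤ minActionRegPr F J K hJK ε₀ V → RegPr F J K ε₀ U) :
    ∃ c₀ : ℝ, 0 < c₀ ∧ c₀ ≤ 1 ∧ ∀ (cw : ℝ), 0 < cw → cw ≤ c₀ → ∃ pS : ℝ, ∀ (b₀ p₀ : ℝ), 0 < b₀ → pS ≤ p₀ → 0 < p₀ →
      ∃ ε₁ : ℝ, 0 < ε₁ ∧ ∀ (ε₀ : ℝ), 0 < ε₀ → ε₀ ≤ ε₁ →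
      ∃ γ₁ : ℝ, 0 < γ₁ ∧ ∀ (F : T3Family) (γ : ℝ), F.L = L → 0 < γ → γ ≤ γ₁ →
        ∀ (J K : ℕ) (hJK : J ≤ K) (V : GaugeField (F.P J) 0 (Matrix.specialUnitaryGroup (Fin 2) ℂ)), PlaqSmall (θBal F.L γ (cw * b₀) p₀ J) V →
          ∀ U₀ ∈ {U' | U' ∈ fibre F ℰp J K hJK V ∧ U' ∈ histGood F ℰp (θBal F.L γ b₀ p₀) K J ∧
              wilsonAction4 U' = minActionRegPr F J K hJK ε₀ V}, ∃ μ : ℝ, 0 < μ ∧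
            ∀ U ∈ fibre F ℰp J K hJK V, U ∈ histGood F ℰp (θBal F.L γ b₀ p₀) K J →
              μ * ((F.L : ℝ)⁻¹) ^ (2 * (K - J)) *
                  (⨅ w : {w : Site (F.P K) 0 → Matrix.specialUnitaryGroup (Fin 2) ℂ |
                      ∀ U : GaugeField (F.P K) 0 (Matrix.specialUnitaryGroup (Fin 2) ℂ),
                        descendTo F ℰp J K hJK (GaugeField.gaugeAct w U) = descendTo F ℰp J K hJK U},
                    ∑ ℓ : PBond (F.P K) 0,
                      dist1 (U ℓ * ((GaugeField.gaugeAct (w : Site (F.P K) 0 → Matrix.specialUnitaryGroup (Fin 2) ℂ) U₀) ℓ)⁻¹) ^ 2)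
                ≤ wilsonAction4 U - minActionRegPr F J K hJK ε₀ V := by
  obtain ⟨c₁, hc₁, hc₁1, h₁⟩ := windowExactnessExistsAt_five L h5
  obtain ⟨c₂, hc₂, -, h₂⟩ := hRA
  refine ⟨min c₁ c₂, lt_min hc₁ hc₂, (min_le_left _ _).trans hc₁1, fun cw hcw0 hcwle => ?_⟩
  obtain ⟨pS₁, h₁'⟩ := h₁ cw hcw0 (hcwle.trans (min_le_left _ _))
  obtain ⟨pS₂, h₂'⟩ := h₂ cw hcw0 (hcwle.trans (min_le_right _ _))
  refine ⟨max pS₁ pS₂, fun b₀ p₀ hb hpS hp => ?_⟩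
  obtain ⟨ε₁, hε₁, h₁''⟩ := h₁' b₀ p₀ hb ((le_max_left _ _).trans hpS) hp
  obtain ⟨ε₂, hε₂, h₂''⟩ := h₂' b₀ p₀ hb ((le_max_right _ _).trans hpS) hp
  obtain ⟨e, γG, he, hγG, HG⟩ := gapFlat_at_min_of_regArgminBar_five L h5 b₀ p₀ hb hp
  refine ⟨min ε₁ (min ε₂ e), lt_min hε₁ (lt_min hε₂ he), fun ε₀ hε₀ hε₀le => ?_⟩
  obtain ⟨γa, hγa, H₁⟩ := h₁'' ε₀ hε₀ (hε₀le.trans (min_le_left _ _))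
  obtain ⟨γb, hγb, H₂⟩ := h₂'' ε₀ hε₀ (hε₀le.trans ((min_le_right _ _).trans (min_le_left _ _)))
  refine ⟨min γa (min γb γG), lt_min hγa (lt_min hγb hγG), fun F γ hFL hγ hγle J K hJK V hV U₀ hU₀ => ?_⟩
  by_cases hJKeq : J = K
  · -- the diagonal layer is pointwise free
    subst hJKeq
    exact ⟨1, one_pos, fun U hU _ => gapOrbit_self F one_pos hJK hU₀ hU⟩
  have hlt : J < K := lt_of_le_of_ne hJK hJKeq
  obtain ⟨U₁, hU₁reg, hU₁good, hU₁min⟩ := H₁ F γ hFL hγ (hγle.trans (min_le_left _ _)) J K hJK V hV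
  have hRAV := H₂ F γ hFL hγ (hγle.trans ((min_le_right _ _).trans (min_le_left _ _))) J K hJK V hV
  obtain ⟨μ, hμ, hGap⟩ := HG F γ hFL hγ (hγle.trans ((min_le_right _ _).trans (min_le_right _ _))) J K hlt ε₀ V U₁ hε₀
    (hε₀le.trans ((min_le_right _ _).trans (min_le_right _ _))) hU₁reg hU₁min hU₁good hRAV
  exact ⟨μ, hμ, gapFlatAt_argmin_of_gapFlatAt F hJK hε₀.le V ((mem_regFibrePr_iff F).mp hU₁reg).1 hμ hGap U₀ hU₀⟩

end Organ

/-! ## §4 ★★★ THE CONVERSE: GAP♭∘ AT `L` GIVES REG-ARGMIN̄∘ AT `L` BACK, every `L ≥ 5` -/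

section Converse

variable (F : T3Family) {J K : ℕ} (hJK : J ≤ K)

/-- ★★ **PER DATUM: GAP♭(V,U₁;μ) AT A (6)-REGULAR FIBRE POINT `U₁` ⟹ REG-ARGMIN̄(V)** (`ε₀ ≥ 0`).  The GAP♭ inequality is a CLOSED condition in `U` (both sides continuous:
✓`continuous_iInf_orbitDistSq`, ✓`continuous_wilsonAction4_SU`; the fibre is closed under it trivially since only `histGood` is being closed), so it holds on
`closure (fibre ∩ histGood)`; an achiever `A U ≤ min₍₆₎` there has orbit distance `≤ 0`, hence `U = w • U₁` with `w` residual (✓`exists_eq_gaugeAct_of_iInf_le_zero`), hence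
`U` is regular with `U₁` (✓`gaugeAct_mem_regFibrePr_iff_of_residual`). [cite: Balaban1985Variational, Thm 1 (8)-(10) p.279 and (142) p.299] -/
theorem regArgminBarAt_of_gapFlatAt {γ b₀ p₀ ε₀ : ℝ} (hε₀ : 0 ≤ ε₀)
    (V : GaugeField (F.P J) 0 (Matrix.specialUnitaryGroup (Fin 2) ℂ)) {U₁ : GaugeField (F.P K) 0 (Matrix.specialUnitaryGroup (Fin 2) ℂ)}
    (hU₁ : U₁ ∈ regFibrePr F J K hJK ε₀ V) {μ : ℝ} (hμ : 0 < μ)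
    (hG : ∀ U ∈ fibre F ℰp J K hJK V, U ∈ histGood F ℰp (θBal F.L γ b₀ p₀) K J →
      μ * ((F.L : ℝ)⁻¹) ^ (2 * (K - J)) *
          (⨅ w : {w : Site (F.P K) 0 → Matrix.specialUnitaryGroup (Fin 2) ℂ |
              ∀ U : GaugeField (F.P K) 0 (Matrix.specialUnitaryGroup (Fin 2) ℂ),
                descendTo F ℰp J K hJK (GaugeField.gaugeAct w U) = descendTo F ℰp J K hJK U},
            ∑ ℓ : PBond (F.P K) 0,
              dist1 (U ℓ * ((GaugeField.gaugeAct (w : Site (F.P K) 0 → Matrix.specialUnitaryGroup (Fin 2) ℂ) U₁) ℓ)⁻¹) ^ 2)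
        ≤ wilsonAction4 U - minActionRegPr F J K hJK ε₀ V) :
    ∀ U ∈ closure (fibre F ℰp J K hJK V ∩ histGood F ℰp (θBal F.L γ b₀ p₀) K J),
      wilsonAction4 U ≤ minActionRegPr F J K hJK ε₀ V → RegPr F J K ε₀ U := by
  intro U hUcl hUle
  have hLpos : (0 : ℝ) < (F.L : ℝ) := Nat.cast_pos.mpr (lt_trans zero_lt_one F.hL.2)
  have hc : 0 < μ * ((F.L : ℝ)⁻¹) ^ (2 * (K - J)) := mul_pos hμ (pow_pos (inv_pos.mpr hLpos) _)
  -- the GAP♭ inequality is a closed condition, hence holds on the closure of the good fibre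
  set g : GaugeField (F.P K) 0 (Matrix.specialUnitaryGroup (Fin 2) ℂ) → ℝ := fun U =>
    μ * ((F.L : ℝ)⁻¹) ^ (2 * (K - J)) *
      (⨅ w : {w : Site (F.P K) 0 → Matrix.specialUnitaryGroup (Fin 2) ℂ |
          ∀ U : GaugeField (F.P K) 0 (Matrix.specialUnitaryGroup (Fin 2) ℂ),
            descendTo F ℰp J K hJK (GaugeField.gaugeAct w U) = descendTo F ℰp J K hJK U},
        ∑ ℓ : PBond (F.P K) 0,
          dist1 (U ℓ * ((GaugeField.gaugeAct (w : Site (F.P K) 0 → Matrix.specialUnitaryGroup (Fin 2) ℂ) U₁) ℓ)⁻¹) ^ 2) with hgdef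
  set f : GaugeField (F.P K) 0 (Matrix.specialUnitaryGroup (Fin 2) ℂ) → ℝ := fun U =>
    wilsonAction4 U - minActionRegPr F J K hJK ε₀ V with hfdef
  have hgc : Continuous g := continuous_const.mul (continuous_iInf_orbitDistSq F hJK U₁)
  have hfc : Continuous f := (B16Thm1BaseAtRecord11.continuous_wilsonAction4_SU (N := 2) (F.P K) 0).sub continuous_const
  have hclosed : IsClosed {U : GaugeField (F.P K) 0 (Matrix.specialUnitaryGroup (Fin 2) ℂ) | g U ≤ f U} := isClosed_le hgc hfc
  have hsub : fibre F ℰp J K hJK V ∩ histGood F ℰp (θBal F.L γ b₀ p₀) K J ⊆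
      {U : GaugeField (F.P K) 0 (Matrix.specialUnitaryGroup (Fin 2) ℂ) | g U ≤ f U} :=
    fun U hU => hG U hU.1 hU.2
  have hUg : g U ≤ f U := (closure_minimal hsub hclosed) hUcl
  have hfU : f U ≤ 0 := by
    show wilsonAction4 U - minActionRegPr F J K hJK ε₀ V ≤ 0
    linarith
  have hinf : (⨅ w : {w : Site (F.P K) 0 → Matrix.specialUnitaryGroup (Fin 2) ℂ |
        ∀ U : GaugeField (F.P K) 0 (Matrix.specialUnitaryGroup (Fin 2) ℂ),
          descendTo F ℰp J K hJK (GaugeField.gaugeAct w U) = descendTo F ℰp J K hJK U},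
      ∑ ℓ : PBond (F.P K) 0,
        dist1 (U ℓ * ((GaugeField.gaugeAct (w : Site (F.P K) 0 → Matrix.specialUnitaryGroup (Fin 2) ℂ) U₁) ℓ)⁻¹) ^ 2) ≤ 0 := by
    by_contra hne
    push Not at hne
    have : 0 < g U := mul_pos hc hne
    linarith
  obtain ⟨w₀, hw₀, rfl⟩ := exists_eq_gaugeAct_of_iInf_le_zero F hJK U U₁ hinf
  exact ((mem_regFibrePr_iff F).mp ((gaugeAct_mem_regFibrePr_iff_of_residual F hJK hε₀ hw₀ U₁ V).mpr hU₁)).2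

/-- ★★★ **THE CONVERSE AT THE ORGAN LEVEL: GAP♭∘-at-`L` ⟹ REG-ARGMIN̄∘-at-`L`, EVERY `L ≥ 5`** (base point = the clause-(2) regular good minimiser of
✓`windowExactnessExistsAt_five`, which lies in `argminHist V`; then `regArgminBarAt_of_gapFlatAt`).  With §3: **at every `L ≥ 5` the v12 candidate organ GAP♭∘ and the
letter REG-ARGMIN̄∘ are EQUIVALENT by kernel** (thresholds re-merged each way). [cite: Balaban1985Variational, Thm 1 (8)-(10) p.279 and (142) p.299] -/
theorem regArgminBarOrganAt_five_of_gapFlatOrganAt (L : ℕ) (h5 : 5 ≤ L)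
    (hG : ∃ c₀ : ℝ, 0 < c₀ ∧ c₀ ≤ 1 ∧ ∀ (cw : ℝ), 0 < cw → cw ≤ c₀ → ∃ pS : ℝ, ∀ (b₀ p₀ : ℝ), 0 < b₀ → pS ≤ p₀ → 0 < p₀ →
      ∃ ε₁ : ℝ, 0 < ε₁ ∧ ∀ (ε₀ : ℝ), 0 < ε₀ → ε₀ ≤ ε₁ →
      ∃ γ₁ : ℝ, 0 < γ₁ ∧ ∀ (F : T3Family) (γ : ℝ), F.L = L → 0 < γ → γ ≤ γ₁ →
        ∀ (J K : ℕ) (hJK : J ≤ K) (V : GaugeField (F.P J) 0 (Matrix.specialUnitaryGroup (Fin 2) ℂ)), PlaqSmall (θBal F.L γ (cw * b₀) p₀ J) V →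
          ∀ U₀ ∈ {U' | U' ∈ fibre F ℰp J K hJK V ∧ U' ∈ histGood F ℰp (θBal F.L γ b₀ p₀) K J ∧
              wilsonAction4 U' = minActionRegPr F J K hJK ε₀ V}, ∃ μ : ℝ, 0 < μ ∧
            ∀ U ∈ fibre F ℰp J K hJK V, U ∈ histGood F ℰp (θBal F.L γ b₀ p₀) K J →
              μ * ((F.L : ℝ)⁻¹) ^ (2 * (K - J)) *
                  (⨅ w : {w : Site (F.P K) 0 → Matrix.specialUnitaryGroup (Fin 2) ℂ |
                      ∀ U : GaugeField (F.P K) 0 (Matrix.specialUnitaryGroup (Fin 2) ℂ),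
                        descendTo F ℰp J K hJK (GaugeField.gaugeAct w U) = descendTo F ℰp J K hJK U},
                    ∑ ℓ : PBond (F.P K) 0,
                      dist1 (U ℓ * ((GaugeField.gaugeAct (w : Site (F.P K) 0 → Matrix.specialUnitaryGroup (Fin 2) ℂ) U₀) ℓ)⁻¹) ^ 2)
                ≤ wilsonAction4 U - minActionRegPr F J K hJK ε₀ V) :
    ∃ c₀ : ℝ, 0 < c₀ ∧ c₀ ≤ 1 ∧ ∀ (cw : ℝ), 0 < cw → cw ≤ c₀ → ∃ pS : ℝ, ∀ (b₀ p₀ : ℝ), 0 < b₀ → pS ≤ p₀ → 0 < p₀ →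
      ∃ ε₁ : ℝ, 0 < ε₁ ∧ ∀ (ε₀ : ℝ), 0 < ε₀ → ε₀ ≤ ε₁ →
      ∃ γ₁ : ℝ, 0 < γ₁ ∧ ∀ (F : T3Family) (γ : ℝ), F.L = L → 0 < γ → γ ≤ γ₁ →
        ∀ (J K : ℕ) (hJK : J ≤ K) (V : GaugeField (F.P J) 0 (Matrix.specialUnitaryGroup (Fin 2) ℂ)), PlaqSmall (θBal F.L γ (cw * b₀) p₀ J) V →
          ∀ U ∈ closure (fibre F ℰp J K hJK V ∩ histGood F ℰp (θBal F.L γ b₀ p₀) K J),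
            wilsonAction4 U ≤ minActionRegPr F J K hJK ε₀ V → RegPr F J K ε₀ U := by
  obtain ⟨c₁, hc₁, hc₁1, h₁⟩ := windowExactnessExistsAt_five L h5
  obtain ⟨c₂, hc₂, -, h₂⟩ := hG
  refine ⟨min c₁ c₂, lt_min hc₁ hc₂, (min_le_left _ _).trans hc₁1, fun cw hcw0 hcwle => ?_⟩
  obtain ⟨pS₁, h₁'⟩ := h₁ cw hcw0 (hcwle.trans (min_le_left _ _))
  obtain ⟨pS₂, h₂'⟩ := h₂ cw hcw0 (hcwle.trans (min_le_right _ _))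
  refine ⟨max pS₁ pS₂, fun b₀ p₀ hb hpS hp => ?_⟩
  obtain ⟨ε₁, hε₁, h₁''⟩ := h₁' b₀ p₀ hb ((le_max_left _ _).trans hpS) hp
  obtain ⟨ε₂, hε₂, h₂''⟩ := h₂' b₀ p₀ hb ((le_max_right _ _).trans hpS) hp
  refine ⟨min ε₁ ε₂, lt_min hε₁ hε₂, fun ε₀ hε₀ hε₀le => ?_⟩
  obtain ⟨γa, hγa, H₁⟩ := h₁'' ε₀ hε₀ (hε₀le.trans (min_le_left _ _))
  obtain ⟨γb, hγb, H₂⟩ := h₂'' ε₀ hε₀ (hε₀le.trans (min_le_right _ _))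
  refine ⟨min γa γb, lt_min hγa hγb, fun F γ hFL hγ hγle J K hJK V hV => ?_⟩
  obtain ⟨U₁, hU₁reg, hU₁good, hU₁min⟩ := H₁ F γ hFL hγ (hγle.trans (min_le_left _ _)) J K hJK V hV
  have hU₁arg : U₁ ∈ {U' | U' ∈ fibre F ℰp J K hJK V ∧ U' ∈ histGood F ℰp (θBal F.L γ b₀ p₀) K J ∧
      wilsonAction4 U' = minActionRegPr F J K hJK ε₀ V} :=
    ⟨((mem_regFibrePr_iff F).mp hU₁reg).1, hU₁good, hU₁min⟩
  obtain ⟨μ, hμ, hGap⟩ := H₂ F γ hFL hγ (hγle.trans (min_le_right _ _)) J K hJK V hV U₁ hU₁arg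
  exact regArgminBarAt_of_gapFlatAt F hJK hε₀.le V hU₁reg hμ hGap

end Converse

end Summit.QuantumFields.YangMills.Theorems.FluctuationComparisonRegPrIntLS2BetaGapFlatOrganOfRegArgminBar

end
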